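import Summits.BirchSwinnertonDyer.BirchSwinnertonDyer.Theorems.CyclotomicUntwistPSTwistInvolutionKodaira
import Summits.BirchSwinnertonDyer.BirchSwinnertonDyer.Theorems.CyclotomicUntwistPSTamagawaThreeLaw
import HarnessLib

/-!
# LAW L-tw3, unit-part layer: the `χ₋₃`-twist involution of the cyclic wild cell at `3` preserves
# `Δ′ = Δ_min/3^{v₃Δ_min}` modulo `9` — principal-series rows go to principal-series rows, and `W₃` flips

Cell `pub/bsd-wall` (D-0145 line `route-BirchSwinnertonDyer-CyclotomicUntwist`), seat `bsd-line-cycu-p4`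
(width seat 4, gen 5). Helper toward the cruxes K1 `PSRankOneLowerHalfAtThree`
(stmt-BirchSwinnertonDyer-21580) and K2 `PSRankOneUpperHalfAtThree` (stmt-21581). THEOREMS ONLY (no
definition, no named fact, no `sorry`); route-free; BSD is not proved by this file and no crux is. Sequel of
`CyclotomicUntwistPSTwistInvolutionKodaira.lean` (Kodaira symbol, `ClassO6`, `v₃Δ_min` and `ord₃ u` of the
twist `C • V^{(±3)} = W` of a curve `V` on the cyclic wild cell).

* §7 **`minimalDiscUnitPartThree_twist_zmod_nine`**: `Δ′(W) ≡ Δ′(V) (mod 9)` for `C • V^{(±3)} = W`, `V`, `W`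
  globally minimal (ANY `E/ℚ`): with `u(C) = N/M` in lowest terms the twist relation clears to
  `N¹²·Δ_min(W) = 3⁶·Δ_min(V)·M¹²` in `ℤ` (`num_pow_mul_minimalDiscriminantInt_twist_eq`); stripping the powers
  of `3` (unique factorisation, `PSTamagawaThree.padicValInt_three_eq_of_eq_pow_mul`) leaves
  `N′¹²·Δ′(W) = Δ′(V)·M′¹²` with `3 ∤ N′M′`, and `x¹² ≡ 1 (mod 9)` for `3 ∤ x` (`decide` over `ℤ/9`). In the
  binder spelling of the route: `Δ_min(W)/3^{v_W} % 3 = Δ_min(V)/3^{v_V} % 3`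
  (`minimalDiscUnitPartThree_twist_emod_three`).
* §8 **`psRow_twist_of_psRow`**: the three row binders of K1/K2 (`ClassO6 · 3`, `v₃Δ_min` even,
  `Δ_min/3^v ≡ 1 (mod 3)`) pass to the twist — PS ↦ PS, and SCu ↦ SCu (`not_psRow_twist_of_not_psRow`, the
  cyclic rows of the residual crux); **`rootNumberThree_twist_of_psRow`: `W₃(W) = −W₃(V)`** on the PS rows
  (LAW L-w3 `PSRootNumberThree.rootNumberThree_of_psRow` on both sides: `v ↦ v ± 6` flips `v mod 4`), while on
  the SCu rows both signs are `+1` (`rootNumberThree_twist_of_not_psRow`).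

READING (informal, not asserted). On the PS rows the untwisting character `η` mod `9` of route `CyclotomicUntwist`
has order `3` (`II`/`II*`) or `6` (`IV`/`IV*`), and `η₆ = η₃ · χ₋₃`: `f_E ⊗ η̄₆ = f_{E ⊗ χ₋₃} ⊗ η̄₃`, so a twist pair
`(E, E ⊗ χ₋₃)` shares ONE untwist newform `g` of level `9M`, its `U₃`-root `α`, and D1's two objects are the
odd / even branches of the one Mazur–Tate–Teitelbaum distribution of `g`; D4's sign `η(−1) = W₃` is opposite on
the two members (this file). Analytic rank and the mod-`3` image are NOT transported by these theorems.

References: A. Kraus, Manuscripta Math. 69 (1990) [Kraus1990]; O. G. Rizzo, Compositio Math. 136 (2003),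
Table II [Rizzo2003]; I. Papadopoulos, J. Number Theory 44 (1993), Table III [Papadopoulos1993];
J. H. Silverman, *AEC* (2009) III.1, VII.1 Prop. 1.3, X.2 Prop. 2.4 [SilvermanAEC2009].
-/

open scoped Classical

open WeierstrassCurve IsDedekindDomain Rat.HeightOneSpectrum Literature.NumberTheory.EllipticCurves
  Literature.NumberTheory.EllipticCurves.Rank1Residual Literature.NumberTheory.DiophantineGeometry
  Summit.BirchSwinnertonDyer.Rank1Residual.Additive

set_option linter.dupNamespace false -- single-conjunct summit: the name repeats by design
set_option autoImplicit false

namespace Summit.BirchSwinnertonDyer.BirchSwinnertonDyer.Theorems.PSTwistInvolution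

/-! ### §7 The unit part `Δ′ = Δ_min / 3^{v₃Δ_min}` is preserved modulo `9` -/

section UnitPart

/-- Twelfth powers of integers prime to `3` are `≡ 1 (mod 9)` (`(ℤ/9)ˣ` has order `6`). [folklore] -/
private theorem pow_twelve_zmod_nine : ∀ x : ZMod 9,
    ZMod.castHom (show 3 ∣ 9 by norm_num) (ZMod 3) x ≠ 0 → x ^ 12 = 1 := by
  decide

/-- Twelfth powers of integers prime to `3` are `≡ 1 (mod 9)`. [folklore] -/
theorem pow_twelve_emod_nine {n : ℤ} (hn : ¬ (3 : ℤ) ∣ n) : ((n ^ 12 : ℤ) : ZMod 9) = 1 := by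
  have h : ZMod.castHom (show 3 ∣ 9 by norm_num) (ZMod 3) (n : ZMod 9) ≠ 0 := by
    rw [map_intCast, Ne, ZMod.intCast_zmod_eq_zero_iff_dvd]; exact_mod_cast hn
  have := pow_twelve_zmod_nine _ h
  push_cast
  exact this

/-- **Cancellation of twelfth powers modulo `9`.** If `A·n¹² = B·m¹²` in `ℤ` with `3 ∤ n`, `3 ∤ m`, then
`A ≡ B (mod 9)`. [folklore] -/
theorem intCast_zmod_nine_eq_of_mul_pow_twelve {A B n m : ℤ} (hn : ¬ (3 : ℤ) ∣ n) (hm : ¬ (3 : ℤ) ∣ m)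
    (h : A * n ^ 12 = B * m ^ 12) : (A : ZMod 9) = (B : ZMod 9) := by
  have h' := congrArg (Int.cast : ℤ → ZMod 9) h
  push_cast at h'
  have hn1 := pow_twelve_emod_nine hn
  have hm1 := pow_twelve_emod_nine hm
  push_cast at hn1 hm1
  rw [hn1, hm1, mul_one, mul_one] at h'
  exact h'

variable (V W : WeierstrassCurve ℚ) [V.IsElliptic] [V.IsGloballyMinimal] [W.IsElliptic] [W.IsGloballyMinimal]

omit [V.IsElliptic] [W.IsElliptic] in
/-- The twist relation on minimal discriminants, CLEARED OF DENOMINATORS: with `u(C) = N/M` in lowest terms,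
`N¹² · Δ_min(W) = d⁶ · Δ_min(V) · M¹²` in `ℤ` (`Δ(C • X) = u⁻¹² Δ(X)`, `Δ(V^{(d)}) = d⁶ Δ(V)`; any `d ∈ ℤ`).
[cite: SilvermanAEC2009, III.1 Table 3.1 and X.2 Prop. 2.4] -/
theorem num_pow_mul_minimalDiscriminantInt_twist_eq {d : ℤ} (C : VariableChange ℚ)
    (hC : C • V.quadraticTwist (d : ℚ) = W) :
    (C.u : ℚ).num ^ 12 * W.minimalDiscriminantInt = d ^ 6 * V.minimalDiscriminantInt * (C.u : ℚ).den ^ 12 := by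
  have hu0 : (C.u : ℚ) ≠ 0 := C.u.ne_zero
  have hden : ((C.u : ℚ).den : ℚ) ≠ 0 := by exact_mod_cast (C.u : ℚ).den_nz
  have hΔ : (W.minimalDiscriminantInt : ℚ) =
      (C.u : ℚ)⁻¹ ^ 12 * ((d : ℚ) ^ 6 * V.minimalDiscriminantInt) := by
    rw [cast_minimalDiscriminantInt, cast_minimalDiscriminantInt, ← hC, variableChange_Δ,
      quadraticTwist_Δ, Units.val_inv_eq_inv_val]
  have key : ((C.u : ℚ).num : ℚ) ^ 12 * W.minimalDiscriminantInt =
      (d : ℚ) ^ 6 * V.minimalDiscriminantInt * ((C.u : ℚ).den : ℚ) ^ 12 := by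
    rw [hΔ]
    have hnum : ((C.u : ℚ).num : ℚ) = (C.u : ℚ) * (C.u : ℚ).den := (Rat.mul_den_eq_num _).symm
    rw [hnum]
    field_simp
  exact_mod_cast key

/-- **The unit parts of the minimal discriminants agree modulo `9` across the twist**:
`Δ_min(W)/3^{v₃Δ_min(W)} ≡ Δ_min(V)/3^{v₃Δ_min(V)} (mod 9)` for `C • V^{(±3)} = W` (`V`, `W` globally minimal, ANY
`E/ℚ`). From `N¹²·Δ_min(W) = 3⁶·Δ_min(V)·M¹²` strip the powers of `3` (unique factorisation) and use
`x¹² ≡ 1 (mod 9)` for `3 ∤ x`. [cite: SilvermanAEC2009, X.2 Prop. 2.4 and VII.1 Prop. 1.3] -/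
theorem minimalDiscUnitPartThree_twist_zmod_nine {d : ℤ} (hd : d = 3 ∨ d = -3) (C : VariableChange ℚ)
    (hC : C • V.quadraticTwist (d : ℚ) = W) :
    (minimalDiscUnitPartThree W : ZMod 9) = (minimalDiscUnitPartThree V : ZMod 9) := by
  have hZ := num_pow_mul_minimalDiscriminantInt_twist_eq V W C hC
  have hu0 : (C.u : ℚ) ≠ 0 := C.u.ne_zero
  have hN0 : (C.u : ℚ).num ≠ 0 := Rat.num_ne_zero.mpr hu0
  have hM0 : ((C.u : ℚ).den : ℤ) ≠ 0 := by exact_mod_cast (C.u : ℚ).den_nz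
  obtain ⟨N', hN, hN'⟩ := PSRootNumberThreeTable.exists_eq_pow_mul_not_dvd hN0
  obtain ⟨M', hM, hM'⟩ := PSRootNumberThreeTable.exists_eq_pow_mul_not_dvd hM0
  have hDV := minimalDiscriminantInt_eq_pow_mul_unitPart V
  have hDW := minimalDiscriminantInt_eq_pow_mul_unitPart W
  have hV' := PSRootNumberThree.not_three_dvd_minimalDiscUnitPartThree V
  have hW' := PSRootNumberThree.not_three_dvd_minimalDiscUnitPartThree W
  have hd6 : d ^ 6 = 3 ^ 6 := by rcases hd with rfl | rfl <;> norm_num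
  set a := padicValInt 3 (C.u : ℚ).num
  set b := padicValInt 3 ((C.u : ℚ).den : ℤ)
  set v := padicValInt 3 V.minimalDiscriminantInt
  set w := padicValInt 3 W.minimalDiscriminantInt
  -- both sides as `3^k · (unit part)`
  have hL : (C.u : ℚ).num ^ 12 * W.minimalDiscriminantInt =
      3 ^ (12 * a + w) * (N' ^ 12 * minimalDiscUnitPartThree W) := by
    rw [hN, hDW]; ring
  have hR : d ^ 6 * V.minimalDiscriminantInt * ((C.u : ℚ).den : ℤ) ^ 12 =
      3 ^ (6 + v + 12 * b) * (minimalDiscUnitPartThree V * M' ^ 12) := by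
    rw [hd6, hM, hDV]; ring
  have h3p : Prime (3 : ℤ) := Int.prime_three
  have hLu : ¬ (3 : ℤ) ∣ N' ^ 12 * minimalDiscUnitPartThree W := fun h ↦ by
    rcases h3p.dvd_or_dvd h with h | h
    · exact hN' (h3p.dvd_of_dvd_pow h)
    · exact hW' h
  have hRu : ¬ (3 : ℤ) ∣ minimalDiscUnitPartThree V * M' ^ 12 := fun h ↦ by
    rcases h3p.dvd_or_dvd h with h | h
    · exact hV' h
    · exact hM' (h3p.dvd_of_dvd_pow h)
  have hkL := PSTamagawaThree.padicValInt_three_eq_of_eq_pow_mul (12 * a + w) hL hLu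
  have hkR := PSTamagawaThree.padicValInt_three_eq_of_eq_pow_mul (6 + v + 12 * b) hR hRu
  have hk : 12 * a + w = 6 + v + 12 * b := by rw [← hkL, ← hkR, hZ]
  have hcore : N' ^ 12 * minimalDiscUnitPartThree W = minimalDiscUnitPartThree V * M' ^ 12 := by
    have h := hZ
    rw [hL, hR, hk] at h
    exact mul_left_cancel₀ (pow_ne_zero _ (by norm_num)) h
  have := intCast_zmod_nine_eq_of_mul_pow_twelve (A := minimalDiscUnitPartThree W)
    (B := minimalDiscUnitPartThree V) hN' hM' (by rw [← hcore]; ring)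
  exact this

/-- **`Δ′ mod 3` is preserved across the twist** (the principal-series predicate of route `CyclotomicUntwist`,
in its binder spelling `Δ_min / 3^{v₃Δ_min} % 3`). [cite: SilvermanAEC2009, X.2 Prop. 2.4] -/
theorem minimalDiscUnitPartThree_twist_emod_three {d : ℤ} (hd : d = 3 ∨ d = -3) (C : VariableChange ℚ)
    (hC : C • V.quadraticTwist (d : ℚ) = W) :
    W.minimalDiscriminantInt / 3 ^ padicValInt 3 W.minimalDiscriminantInt % 3 =
      V.minimalDiscriminantInt / 3 ^ padicValInt 3 V.minimalDiscriminantInt % 3 := by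
  have h9 := minimalDiscUnitPartThree_twist_zmod_nine V W hd C hC
  have h3 : (minimalDiscUnitPartThree W : ZMod 3) = (minimalDiscUnitPartThree V : ZMod 3) := by
    have := congrArg (ZMod.castHom (show 3 ∣ 9 by norm_num) (ZMod 3)) h9
    rwa [map_intCast, map_intCast] at this
  have hm := (ZMod.intCast_eq_intCast_iff _ _ 3).mp h3
  unfold Int.ModEq at hm
  exact_mod_cast hm

end UnitPart

/-! ### §8 Principal-series rows go to principal-series rows; the sign `W₃` flips -/

section PSRows

variable (V W : WeierstrassCurve ℚ) [V.IsElliptic] [V.IsGloballyMinimal] [W.IsElliptic] [W.IsGloballyMinimal]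

/-- **PS ↦ PS.** The `±3`-twist of a curve on a PRINCIPAL-SERIES row of route `CyclotomicUntwist`
(`ClassO6 V 3`, `v₃Δ_min` even, `Δ_min/3^v ≡ 1 (mod 3)`: `Δ_min ∈ (ℚ₃ˣ)²`) is again on a principal-series row —
the three binders of the cruxes K1/K2 transported (the rank-one and image binders are NOT transported:
`r_an` and `ρ̄₃` are not twist-invariants in this sense). [cite: Kraus1990, Théorème (p = 3)]
[cite: SilvermanAEC2009, X.2 Prop. 2.4] -/
theorem psRow_twist_of_psRow (hO6 : ClassO6 V 3) (hev : Even (padicValInt 3 V.minimalDiscriminantInt))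
    (hps : V.minimalDiscriminantInt / 3 ^ padicValInt 3 V.minimalDiscriminantInt % 3 = 1)
    {d : ℤ} (hd : d = 3 ∨ d = -3) (C : VariableChange ℚ) (hC : C • V.quadraticTwist (d : ℚ) = W) :
    ClassO6 W 3 ∧ Even (padicValInt 3 W.minimalDiscriminantInt) ∧
      W.minimalDiscriminantInt / 3 ^ padicValInt 3 W.minimalDiscriminantInt % 3 = 1 :=
  ⟨classO6_twist_of_cyclic W V hO6 hev hd C hC, even_twist_of_cyclic V W hO6 hev hd C hC,
    (minimalDiscUnitPartThree_twist_emod_three V W hd C hC).trans hps⟩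

/-- **SCu ↦ SCu.** On the cyclic rows that are NOT principal series (`Δ_min/3^v ≢ 1 (mod 3)`, the
supercuspidal-unramified rows of the residual crux `WildSurjRankOneSupercuspidalAtThree`) the twist is again
such a row. [cite: Kraus1990, Théorème (p = 3)] [cite: SilvermanAEC2009, X.2 Prop. 2.4] -/
theorem not_psRow_twist_of_not_psRow (hO6 : ClassO6 V 3) (hev : Even (padicValInt 3 V.minimalDiscriminantInt))
    (hns : V.minimalDiscriminantInt / 3 ^ padicValInt 3 V.minimalDiscriminantInt % 3 ≠ 1)
    {d : ℤ} (hd : d = 3 ∨ d = -3) (C : VariableChange ℚ) (hC : C • V.quadraticTwist (d : ℚ) = W) :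
    ClassO6 W 3 ∧ Even (padicValInt 3 W.minimalDiscriminantInt) ∧
      W.minimalDiscriminantInt / 3 ^ padicValInt 3 W.minimalDiscriminantInt % 3 ≠ 1 :=
  ⟨classO6_twist_of_cyclic W V hO6 hev hd C hC, even_twist_of_cyclic V W hO6 hev hd C hC,
    fun h ↦ hns ((minimalDiscUnitPartThree_twist_emod_three V W hd C hC).symm.trans h)⟩

/-- **The local root number at `3` FLIPS across the twist on the principal-series rows**:
`W₃(W) = −W₃(V)` (LAW L-w3, `PSRootNumberThree.rootNumberThree_of_psRow`: `W₃ = −1` iff `v₃Δ_min ≡ 2 (mod 4)`,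
and `v ↦ v ± 6` changes `v mod 4`). For the route: the sign `η(−1) = W₃` of D4's pinned constant
`κ = 9η(−1)/α²` is opposite on the two members of a twist pair sharing the untwist newform `g`.
[cite: Rizzo2003, Table II (p. 4), rows (2,3,4), (3,5,6), (4,6,10), (1,2,0)] [cite: Kraus1990, Théorème (p = 3)] -/
theorem rootNumberThree_twist_of_psRow (hO6 : ClassO6 V 3) (hev : Even (padicValInt 3 V.minimalDiscriminantInt))
    (hps : V.minimalDiscriminantInt / 3 ^ padicValInt 3 V.minimalDiscriminantInt % 3 = 1)
    {d : ℤ} (hd : d = 3 ∨ d = -3) (C : VariableChange ℚ) (hC : C • V.quadraticTwist (d : ℚ) = W) :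
    W.rootNumberThree = -V.rootNumberThree := by
  obtain ⟨hO6W, hevW, hpsW⟩ := psRow_twist_of_psRow V W hO6 hev hps hd C hC
  rw [PSRootNumberThree.rootNumberThree_of_psRow V hO6 hev hps,
    PSRootNumberThree.rootNumberThree_of_psRow W hO6W hevW hpsW]
  rcases padicValInt_minimalDiscriminantInt_twist_of_cyclic V W hO6 hev hd C hC with
    ⟨hv, hw, -⟩ | ⟨hv, hw, -⟩ | ⟨hv, hw, -⟩ | ⟨hv, hw, -⟩ <;> rw [hv, hw] <;> decide

/-- On the NON-principal-series cyclic rows the sign does not move: `W₃(W) = W₃(V) = +1`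
(`PSRootNumberThree.rootNumberThree_eq_one_of_even_of_not_psRow` on both sides).
[cite: Rizzo2003, Table II (p. 4)] -/
theorem rootNumberThree_twist_of_not_psRow (hO6 : ClassO6 V 3) (hev : Even (padicValInt 3 V.minimalDiscriminantInt))
    (hns : V.minimalDiscriminantInt / 3 ^ padicValInt 3 V.minimalDiscriminantInt % 3 ≠ 1)
    {d : ℤ} (hd : d = 3 ∨ d = -3) (C : VariableChange ℚ) (hC : C • V.quadraticTwist (d : ℚ) = W) :
    W.rootNumberThree = 1 ∧ V.rootNumberThree = 1 := by
  obtain ⟨hO6W, hevW, hnsW⟩ := not_psRow_twist_of_not_psRow V W hO6 hev hns hd C hC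
  exact ⟨PSRootNumberThree.rootNumberThree_eq_one_of_even_of_not_psRow W hO6W.2.1 hO6W.2.2 hevW hnsW,
    PSRootNumberThree.rootNumberThree_eq_one_of_even_of_not_psRow V hO6.2.1 hO6.2.2 hev hns⟩

end PSRows

end Summit.BirchSwinnertonDyer.BirchSwinnertonDyer.Theorems.PSTwistInvolution
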